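import Summits.QuantumFields.YangMills.Theorems.BalabanUVNodesK0Stub2PrimeHolds
import Summits.QuantumFields.YangMills.Theorems.BalabanUVNodesK0V19Defs

/-!
# K0⁷ V19 — REGISTERED STUB 2′ BY NAME: `stub_prop6MemberB8AtP13 : ∀ F : T4Family, Prop6MemberB8AtP F`

Cell `pub-ymgap`, width seat `pub-ymgap-k0-s2-w1` (g0; director-ym №197 ∕ HUMAN RULING D-0149).  `--kind proof --supports stmt-QuantumFields-20541` (NO `--as helper`: this file proves
the REGISTERED stub 2′ of plan g81's K0⁷ skeleton V19 `[YMPLAN-G81-K0V19-REGISTERED 87879403b3a26109]` BY NAME + SIGNATURE; plan WORD bus l.≈26568 «file the BY-NAME closer … no plan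
objection; NO V20»; dag-n21-c WORD-STUB2P l.26447; dag-lead GATE v1.55 0080223fed7ff525).  [6] = [Balaban1985RegularSpaces]; [4] = [Balaban1985BackgroundPropagators]; [15] = [Balaban1985Variational].

WHAT THIS FILE PROVES (theorems only; 0 `def`; nothing modified).
§1 ★★★ `stub_prop6MemberB8AtP13 : ∀ F : T4Family, Prop6MemberB8AtP F` — the registered stub's VERBATIM header; the predicate is this seat's tree mirror
   `K0V19Defs.Prop6MemberB8AtP` (= the skeleton's l.72–74 byte-for-byte: `∃ (ρ₀ : ℕ) (B₁ c₁ : ℝ), 1 ≤ ρ₀ ∧ 0 ≤ B₁ ∧ 0 < c₁ ∧ B8.Prop6Printed 4 (F.L : ℝ) B₁ c₁ (fun i : ZdIdx 4 F.L =>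
   zdCubP (MatA 2) F.L ρ₀ i)` at `𝔸 = M₂(ℂ)`); the proof is `K0Stub2PrimeHolds.prop6MemberB8AtP_holds` (p593845: dag-n05-c's T4 `ineq159FlatCubeMemberPrinted_holds` → dag-n05-e's Fγ10b
   `gaugedBoundB8_cubeMember_scalar_γ_of_ineq159Printed` → this seat's junction `prop6MemberB8AtP_of_perCubeLetterPow`, p590333), hypothesis-free, standard axioms.
§2 `record13SepCoPHInhabited_of_stub1_stub3A'_byName` — K0⁷ BY NAME from the by-name TEXTS of stubs 1 and 3ᴬ′ (`K0V19Defs.record13SepCoPHInhabited_of_stubTexts` = (b3) PART 2, with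
   the stub-2′ slot filled by §1).  CONDITIONAL on those two texts — displayed, NOT inhabited here.

HONEST SCOPE ∕ A1–A6.  (A1) K0⁷ stmt-QuantumFields-20541 stays OPEN: §2 concludes the route decl ONLY under the texts of stubs 1 ([15] Prop. 8's top step, N07 ∕ k0-s1) and 3ᴬ′ (NODE O;
print-STATED [Balaban1987RG1] §1 p.264, proof unpublished [Balaban1989LargeFieldII] p.355).  (A2) §1 inhabits stub 2′'s sentence AS TYPED — [6] Prop. 6's conclusion in NODE 00's
letters `GaugedBoundB8` on print's p. 98 cube class `IsPrint ρ₀` above thresholds, small-field class `InAk`, `7dL²Mα₀ ≤ c₁`; the witness `ρ₀` is Fγ10b's threshold block (cube type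
inhabited: dag-n07-e `isPrint_propCubeP`); whether those letters carry print's full (1.135)–(1.138) content is the carriers' LOCATED question of record (referees' call; k0-s2-w2 #22
LOCATED-CARRIER concerned V18's WIDER class — 2′ ≤ print).  V18's stub 2 (ALL `CubeB8` cubes) is NOT claimed.  (A3) no restatement: §1's type IS the registered text over the mirrored
predicate.  (A4) witnesses are p593845's.  (A6) nothing stronger than print asserted — two by-name lines.  Counts unmoved (typed 28∕28 · discharged 5∕27) — count and stub-credit words
belong to the gate ∕ chair ∕ director.  One finite 𝕋⁴ programme at fixed `ε = L^{−K}`, Bałaban AS PRINTED — NOT continuum ∕ ℝ⁴ ∕ OS ∕ mass gap ∕ Clay: the Yang–Mills mass gap is NOT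
proved by any of this; route R4 closes the CONDITIONAL finite-𝕋⁴ rung `BalabanLadder.UV` only.  No `sorry`, `def`, `instance`, `notation`; standard axioms.
-/

noncomputable section

open scoped Matrix.Norms.L2Operator

namespace Summit.QuantumFields.YangMills.Theorems.K0V19Stub2Prime

open Literature.MathematicalPhysics.QuantumFieldTheory.Balaban1983to89
open Literature.MathematicalPhysics.QuantumFieldTheory.Balaban1983to89.T4Continuum
open Summit.QuantumFields.YangMills.Theorems.K0V19Defs (Prop8StepCoPAt Prop6MemberB8AtP AbsBetaBoxAtThm1WitnessCCMGenAt record13SepCoPHInhabited_of_stubTexts)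
open Summit.QuantumFields.YangMills.Theorems.K0Stub2PrimeHolds (prop6MemberB8AtP_holds)

/-! ## §1 ★★★ V19's registered stub 2′ by name -/

/-- **★★★ STUB 2′ OF THE REGISTERED K0⁷ SKELETON V19, BY NAME** (`stub_prop6MemberB8AtP13 : ∀ F : T4Family, Prop6MemberB8AtP F`, plan g81 87879403b3a26109; predicate =
`K0V19Defs.Prop6MemberB8AtP`, the skeleton's text byte-for-byte): [6] Proposition 6 ((1.135)–(1.138), conclusion `GaugedBoundB8`) at EVERY print-faithful cube `zdCubP (MatA 2) F.L ρ₀`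
of NODE 00's family for SOME big-block size `ρ₀ ≥ 1` and constants `B₁ ≥ 0`, `c₁ > 0` — `K0Stub2PrimeHolds.prop6MemberB8AtP_holds` (T4 → Fγ10b → junction).  V18's stub 2 is NOT claimed.
[cite: Balaban1985RegularSpaces, Prop. 6 (1.135)–(1.138) p.99, p.98, Thm 4 p.88, Prop. 3 p.87, (1.59) p.86; Balaban1985BackgroundPropagators, Thm 3.3 p.399] -/
theorem stub_prop6MemberB8AtP13 : ∀ F : T4Family, Prop6MemberB8AtP F :=
  fun F => prop6MemberB8AtP_holds F

/-! ## §2 K0⁷ by name from the texts of stubs 1 and 3ᴬ′ -/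

/-- **K0⁷ BY NAME FROM THE TEXTS OF STUBS 1 AND 3ᴬ′** — `K0V19Defs.record13SepCoPHInhabited_of_stubTexts` ((b3) PART 2 `record13SepCoPHBody_of_stubs1_2P_3A'`) with the stub-2′ slot filled
by §1.  CONDITIONAL on `h1` (stub 1's text) and `h3A'` (stub 3ᴬ′'s text), displayed, not inhabited here; K0⁷ NOT closed.
[cite: Balaban1985Variational, Thm 1 (8)–(9) p.279, Prop. 8 p.304; Balaban1985RegularSpaces, Prop. 6 p.99, p.98; Balaban1988Convergent, Thm 1 p.262; Balaban1987RG1, Thm 1 p.259, §1 p.264] -/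
theorem record13SepCoPHInhabited_of_stub1_stub3A'_byName (h1 : ∀ F : T4Family, Prop8StepCoPAt F)
    (h3A' : ∀ F : T4Family, AbsBetaBoxAtThm1WitnessCCMGenAt F) :
    Summit.QuantumFields.YangMills.Theses.BalabanUVNodes.Record13SepCoPHInhabited :=
  record13SepCoPHInhabited_of_stubTexts h1 stub_prop6MemberB8AtP13 h3A'

end Summit.QuantumFields.YangMills.Theorems.K0V19Stub2Prime

end
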